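import Mathlib
import Summits.NavierStokesRegularity.NavierStokesRegularity.Theorems.SubOnsagerCeilingDefs
import Summits.NavierStokesRegularity.NavierStokesRegularity.Theorems.SubOnsagerCeilingKPBarrierCurrency
import Summits.NavierStokesRegularity.NavierStokesRegularity.Theorems.SubcriticalEnvelopeForwardSourceTailEnvelopeKPDyadicRatioTwo
import HarnessLib

/-!
# The registered stubs of the line «shell-barrier» are jointly EQUIVALENT to the crux `OrthantTailCeiling`
(helper file for the aside crux `SubOnsagerCeiling.OrthantTailCeiling`, stmt-NavierStokesRegularity-25507, `--supports`;
hand leafhand-ns-subonsagerceiling-4 gen 4)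

The registered skeleton `Cruxes/OrthantTailCeiling/Lines/shell_barrier.lean` closes the crux `OrthantTailCeiling`
(`= ∀ R ≥ 1, ∀ ε₀ ∈ (0,1], ∀ α, CeilingAt R ε₀ α`, `orthantTailCeiling_iff_ceilingAt`) from the two registered stubs
`Sig.stub_barrierLargeRatio` (`1/4 < ε₀ ≤ 1`) and `Sig.stub_barrierSmallRatio` (`0 < ε₀ ≤ 1/4`), both of the shape
`∀ …, ShellBarrierAt R ε₀ α` (`Theorems/SubOnsagerCeilingDefs.lean`). Since the two per-table currencies agree —
`kpShellBarrierAt_of_ceilingAt` (one-term window of the tail sum) and `subOnsagerCeiling_ceilingAt_of_shellBarrierAt`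
(geometric series), both landed — this file records BY NAME:

* `orthantStubs_of_orthantTailCeiling` — `OrthantTailCeiling → Sig.stub_barrierLargeRatio ∧ Sig.stub_barrierSmallRatio`;
* `orthantTailCeiling_of_orthantStubs` — the converse (the skeleton's composition, restated on importable names);
* `orthantTailCeiling_iff_orthantStubs` — the equivalence: the line is LOSSLESS;
* `not_orthantTailCeiling_of_not_stubLarge` / `…_of_not_stubSmall` — contrapositives: every refutation of a registered
  stub (e.g. lineage leafhand-3's negative lemmas `¬ Sig.stub_barrierLargeRatio` modulo a side-branch escape
  hypothesis, `Theorems/SubOnsagerCeilingSideBranchShellBarrierCritical.lean`) is by name a refutation of the crux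
  under the same hypothesis.

HONEST FRAMING: bookkeeping about Tao-type MODEL lattice ODEs (route SubOnsagerCeiling, rung TL-M2Break); `OrthantTailCeiling`
is an ASIDE of record (refuted in numerics by the dead-end pocket witness α_SB; not re-litigated here); no stub, crux or
summit is proved and nothing here bears on Navier–Stokes regularity. [cite: Tao2016AveragedNS, §4 (4.13)]
-/

noncomputable section

-- the sub-problem namespace `NavierStokesRegularity.NavierStokesRegularity` is the tree's layout (D-0017)
set_option linter.dupNamespace false

namespace Summit.NavierStokesRegularity.NavierStokesRegularity.Theorems

open Summit.NavierStokesRegularity.NavierStokesRegularity.Theses.SubOnsagerCeiling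
open Summit.NavierStokesRegularity.NavierStokesRegularity.Theorems.SubOnsagerCeiling

/-- **Crux ⇒ both registered stubs**: `CeilingAt ⇒ ShellBarrierAt` per table (`kpShellBarrierAt_of_ceilingAt`), split by
the ratio regime. [cite: Tao2016AveragedNS, §4 (4.13)] -/
theorem orthantStubs_of_orthantTailCeiling (h : OrthantTailCeiling) :
    Sig.stub_barrierLargeRatio ∧ Sig.stub_barrierSmallRatio := by
  rw [orthantTailCeiling_iff_ceilingAt] at h
  exact ⟨fun R hR ε₀ h0 h1 α => kpShellBarrierAt_of_ceilingAt (by linarith) (h R hR ε₀ (by linarith) h1 α),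
    fun R hR ε₀ h0 h1 α => kpShellBarrierAt_of_ceilingAt h0 (h R hR ε₀ h0 (by linarith) α)⟩

/-- **Both registered stubs ⇒ crux** (the skeleton's composition on importable names): `ShellBarrierAt ⇒ CeilingAt`
per table (`subOnsagerCeiling_ceilingAt_of_shellBarrierAt`, geometric series), case split at `ε₀ = 1/4`.
[cite: Tao2016AveragedNS, §4 (4.13)] -/
theorem orthantTailCeiling_of_orthantStubs (h1 : Sig.stub_barrierLargeRatio) (h2 : Sig.stub_barrierSmallRatio) :
    OrthantTailCeiling := by
  rw [orthantTailCeiling_iff_ceilingAt]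
  intro R hR ε₀ h0 hle α
  by_cases hq : ε₀ ≤ 1 / 4
  · exact subOnsagerCeiling_ceilingAt_of_shellBarrierAt h0 (h2 R hR ε₀ h0 hq α)
  · exact subOnsagerCeiling_ceilingAt_of_shellBarrierAt h0 (h1 R hR ε₀ (lt_of_not_ge hq) hle α)

/-- **The line «shell-barrier» is lossless**: its two registered stubs are jointly equivalent to the crux.
[cite: Tao2016AveragedNS, §4 (4.13)] -/
theorem orthantTailCeiling_iff_orthantStubs :
    OrthantTailCeiling ↔ Sig.stub_barrierLargeRatio ∧ Sig.stub_barrierSmallRatio :=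
  ⟨orthantStubs_of_orthantTailCeiling, fun h => orthantTailCeiling_of_orthantStubs h.1 h.2⟩

/-- Contrapositive, large-ratio stub: a refutation of `Sig.stub_barrierLargeRatio` refutes the crux.
[cite: Tao2016AveragedNS, §4 (4.13)] -/
theorem not_orthantTailCeiling_of_not_stubLarge (h : ¬ Sig.stub_barrierLargeRatio) : ¬ OrthantTailCeiling :=
  fun hc => h (orthantStubs_of_orthantTailCeiling hc).1

/-- Contrapositive, small-ratio stub: a refutation of `Sig.stub_barrierSmallRatio` refutes the crux.
[cite: Tao2016AveragedNS, §4 (4.13)] -/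
theorem not_orthantTailCeiling_of_not_stubSmall (h : ¬ Sig.stub_barrierSmallRatio) : ¬ OrthantTailCeiling :=
  fun hc => h (orthantStubs_of_orthantTailCeiling hc).2

end Summit.NavierStokesRegularity.NavierStokesRegularity.Theorems

end
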